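import Summits.CriticalPhenomena.PercolationContinuityZ3.Theorems.PercNearOneGluingNoHeavyQuantGateMoveBlob
import HarnessLib

/-!
# QUANT lane R8, T-DEC, leg (III): SDEC (up to any gate level) is closed under hanging a heavy BLOB `{0, a; g}` beside any law with
# NO ATOM STRICTLY INSIDE `(0, a)`; hence every heavy blob law and every GATED TWO-BLOB law `gate_q({0,a;g} ∗ {0,b;g′})` is SDEC

builds on p205010 (kernel theorem, internal audit signed; external expert review pending)

Support file (`--supports stmt-CriticalPhenomena-4575`), QUANT lane seat prim-quant-arm-2 (gen 35), rung R8 of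
`run/shared/lean/prim/quant/LADDER.md`.  Theorems only, standard axioms, no sorries, no definitions.  Generalises typer g27's
`LawDec.sdecUpTo_slice_relay` (`…QuantGateMoveBlob`, the case `a = 1`) verbatim: the move lemma `decAtT_gateMoveBlob` needs only that no
UNSHIFTED atom lies strictly inside `(0, a)` (`hsupp`), which for `ν = gate_q μ` is the gap hypothesis `μ k = 0` (`0 < k < a`) of this file, and
the slice theorem `sliceClosedWindowT_holds` supplies the slice datum.

* **`LawDec.sdecUpTo_slice_of_gap`** — `μ` a top-affordable probability law on `{0..M}` with `μ k = 0` for `0 < k < a`, `x ≤ g ≤ 1`, `1 ≤ a`: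
  `SDECUpTo x Q M μ → SDECUpTo x Q (M + a) (slice μ a g)`.
* **`LawDec.sdecUpTo_blob`** — the heavy blob law `TP[0, a, g]` (`x ≤ g ≤ 1`, `1 ≤ a`) is `SDECUpTo x Q a` (the case `μ = δ₀`).
* `LawDec.slice_blob_comm` — `slice TP[0,a,g] b g′ = slice TP[0,b,g′] a g` (the two-blob law, commutativity).
* **`LawDec.sdecUpTo_twoBlob`** — the two-blob law `slice TP[0,a,g] b g′` (`x ≤ g, g′ ≤ 1`, `1 ≤ a, b`) is `SDECUpTo x Q (a + b)`: under every
  common gate `q ≤ Q` the law `gate_q({0,a;g} ∗ {0,b;g′})` is DEC at every layer at floor `q·x` — slice the blob with the LARGER atom by the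
  other one (its only positive atom is not inside the smaller blob's gap).  Tree reading: two relay bunches of sizes `a`, `b` and gates `g, g′ ≥ x`
  hung under a common gate are SDEC.  This is the base law of the companion file `…QuantGatedSliceMixLawHeavyTop` (the `θ = 0` cells of
  `GatedSliceMixLaw′` with a heavy top, via typer g26's gated shift).
HONEST STATUS: `WindowMixDEC` / `GatedSliceMixLaw'` / `SingleGateConvClosed` / `TreeDEC` / `FarTreeRow` remain OPEN; the RATE class log\* and
the honest sentence of `run/shared/lean/prim/quant/README.md` are unchanged.

[this work]; the move lemma and the relay case: prim-quant-stmt g27; the slice theorem: prim-quant-census-2 g54–g55 / prim-quant-stmt g24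
(this lane).  Nothing here is cited as a published result.  The gluing rows served [cite: KozmaNitzan2024, Conjecture 3 (p. 15)]; product
measure [cite: Grimmett1999, §1.3 p. 10].
-/

noncomputable section

namespace Summit.CriticalPhenomena.PercolationContinuityZ3.Theorems

namespace Quant

open Finset

/-- the two-point law `{lo, hi; g}` (as in `…QuantLawDEC`) -/
local notation3 "TP[" lo ", " hi ", " g ", " h "]" =>
  (g : ℝ) * (if (h : ℕ) = (hi : ℕ) then (1 : ℝ) else 0) + (1 - (g : ℝ)) * (if (h : ℕ) = (lo : ℕ) then (1 : ℝ) else 0)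

namespace LawDec

/-! ### SDEC is closed under hanging a heavy blob beside a law with no atom strictly inside the blob's range -/

/-- **SDEC-UP-TO-`Q` IS CLOSED UNDER SLICING BY A HEAVY BLOB `{0, a; g}` WHEN `μ` HAS NO ATOM IN `(0, a)`** (`x ≤ g ≤ 1`, `1 ≤ a`):
`μ` a top-affordable probability law on `{0..M}` with `μ k = 0` for `0 < k < a`, SDEC up to `Q` at floor `x` (`0 < x`, `Q ≤ 1`, `Qx < 1`)
⟹ `slice μ a g` is SDEC up to `Q` at `x` on `{0..M+a}`.  Per gate `q ≤ Q`: the slice theorem gives `slice (gate_q μ) a g ∈ D(qT + ag)` and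
`decAtT_gateMoveBlob` (`ν = gate_q μ`, `z = 1 − q`, `y = qx ≤ qg`; `hsupp` from the gap) turns it into `gate_q (slice μ a g) ∈ D(q(T + ag))`.
The case `a = 1` is `sdecUpTo_slice_relay`. [this work] -/
theorem sdecUpTo_slice_of_gap (x Q g : ℝ) (a M : ℕ) (μ : ℕ → ℝ) (hx0 : 0 < x) (hQ1 : Q ≤ 1) (hQx : Q * x < 1)
    (hxg : x ≤ g) (hg1 : g ≤ 1) (ha : 1 ≤ a) (hμ0 : ∀ h, 0 ≤ μ h) (hμM : ∀ h, M < h → μ h = 0)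
    (hμ1 : ∑ h ∈ Finset.range (M + 1), μ h = 1)
    (hta : x * (M : ℝ) ≤ ∑ h ∈ Finset.range (M + 1), (h : ℝ) * μ h)
    (hgap : ∀ k, 0 < k → k < a → μ k = 0)
    (hS : SDECUpTo x Q M μ) :
    SDECUpTo x Q (M + a) (slice μ a g) := by
  intro q hq0 hqQ j hj
  set T : ℝ := ∑ h ∈ Finset.range (M + 1), (h : ℝ) * μ h with hT
  set y : ℝ := q * x with hy
  have hq1 : q ≤ 1 := hqQ.trans hQ1
  have hy0 : 0 < y := mul_pos hq0 hx0
  have hy1 : y < 1 := lt_of_le_of_lt (mul_le_mul_of_nonneg_right hqQ hx0.le) hQx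
  have hyqg : y ≤ q * g := mul_le_mul_of_nonneg_left hxg hq0.le
  have hqg1 : q * g ≤ 1 := by nlinarith
  have ha0 : (0 : ℝ) ≤ (a : ℝ) := Nat.cast_nonneg a
  obtain ⟨n0, nM, n1⟩ := gate_laws M μ q hq0.le hq1 hμ0 hμM hμ1
  have nmean : ∑ h ∈ Finset.range (M + 1), (h : ℝ) * gate μ q h = q * T := sum_mul_gate μ q M
  have htaν : y * (M : ℝ) ≤ q * T := by rw [hy, mul_assoc]; exact mul_le_mul_of_nonneg_left hta hq0.le
  -- the slice theorem: `slice (gate_q μ) a g` is DEC(j) at `qT + ag`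
  have hΛ : DECAtT y (q * T + (a : ℝ) * g) j (M + a) (slice (gate μ q) a g) := by
    refine sliceClosedWindowT_holds y g (q * T) M a j (gate μ q) hy0 hy1 (hyqg.trans (by nlinarith)) hg1 ha n0 nM n1
      (by omega) ?_
    intro j'' _ _
    by_cases hjM : j'' < M
    · have := hS q hq0 hqQ j'' hjM
      rwa [decAt_iff_decAtT, nmean] at this
    · have htop : ∀ h, 0 < gate μ q h → y * (h : ℝ) ≤ ∑ k ∈ Finset.range (M + 1), (k : ℝ) * gate μ q k := by
        intro h hh
        have hhM : h ≤ M := by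
          by_contra hc
          exact (ne_of_gt hh) (nM h (not_le.1 hc))
        rw [nmean]
        have : y * (h : ℝ) ≤ y * M := mul_le_mul_of_nonneg_left (by exact_mod_cast hhM) hy0.le
        linarith
      have := decAt_of_top_le M (gate μ q) n0 nM n1 y hy1 htop j'' (not_lt.1 hjM)
      rwa [decAt_iff_decAtT, nmean] at this
  have hzν : 1 - q ≤ gate μ q 0 := by
    have e : gate μ q 0 = q * μ 0 + (1 - q) := by simp [gate]
    rw [e]; nlinarith [hμ0 0]
  have hsupp : ∀ k, 0 < k → k < a → (1 - g) * gate μ q k = 0 := by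
    intro k hk hka
    have e : gate μ q k = q * μ k + (if k = 0 then 1 - q else 0) := rfl
    rw [e, hgap k hk hka, if_neg (by omega)]; ring
  have hmove := decAtT_gateMoveBlob y (1 - q) g (q * T) a j M (gate μ q) hy0 hy1 (by linarith) hg1
    (by rw [hy]; nlinarith) ha n0 nM n1 nmean.symm htaν hzν hsupp hΛ
  have hlaw : (fun h => slice (gate μ q) a g h + g * (1 - q) * ((if h = 0 then (1 : ℝ) else 0) - (if h = a then (1 : ℝ) else 0)))
      = gate (slice μ a g) q := by
    funext h
    simp only [gate, slice]
    by_cases h0 : h = 0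
    · subst h0
      have hna : ¬ (a ≤ 0) := by omega
      have h0a : (0 : ℕ) ≠ a := by omega
      simp [hna, h0a]; ring
    · by_cases h1 : h = a
      · subst h1; simp [h0]; ring
      · by_cases hle : a ≤ h
        · have : h - a ≠ 0 := by omega
          simp only [if_neg h0, if_neg h1, if_pos hle, if_neg this]
          ring
        · simp only [if_neg h0, if_neg h1, if_neg hle]
          ring
  have hsmean : ∑ h ∈ Finset.range (M + a + 1), (h : ℝ) * slice μ a g h = T + (a : ℝ) * g := sum_mul_slice μ a g M hμM hμ1
  rw [decAt_iff_decAtT, sum_mul_gate, hsmean]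
  have et : q * (T + (a : ℝ) * g) = q * T + (a : ℝ) * g - (1 - q) * (a : ℝ) * g := by ring
  rw [et, ← hlaw]
  exact hmove

/-! ### The heavy blob law and the gated two-blob law -/

/-- `slice δ₀ a g` is the blob law `TP[0, a, g]`. [this work] -/
theorem slice_delta_zero (a : ℕ) (g : ℝ) (ha : 1 ≤ a) :
    slice (fun h => if h = 0 then (1 : ℝ) else 0) a g = fun h => TP[0, a, g, h] := by
  funext h
  simp only [slice]
  by_cases hle : a ≤ h
  · have e : (h - a = 0) ↔ (h = a) := by omega
    have h0 : h ≠ 0 := by omega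
    rw [if_pos hle, if_neg h0]
    by_cases hha : h = a
    · rw [if_pos (e.2 hha), if_pos hha]; ring
    · rw [if_neg (fun hc => hha (e.1 hc)), if_neg hha]; ring
  · have hha : h ≠ a := by omega
    rw [if_neg hle, if_neg hha]
    split_ifs <;> ring

/-- **THE HEAVY BLOB LAW IS SDEC UP TO EVERY LEVEL**: `0 < x`, `Q ≤ 1`, `Qx < 1`, `x ≤ g ≤ 1`, `1 ≤ a` ⟹ `SDECUpTo x Q a TP[0, a, g]`
(`sdecUpTo_slice_of_gap` for `μ = δ₀`, `M = 0`). [this work] -/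
theorem sdecUpTo_blob (x Q g : ℝ) (a : ℕ) (hx0 : 0 < x) (hQ1 : Q ≤ 1) (hQx : Q * x < 1) (hxg : x ≤ g) (hg1 : g ≤ 1) (ha : 1 ≤ a) :
    SDECUpTo x Q a (fun h => TP[0, a, g, h]) := by
  have h := sdecUpTo_slice_of_gap x Q g a 0 (fun h => if h = 0 then (1 : ℝ) else 0) hx0 hQ1 hQx hxg hg1 ha
    (fun h => by show (0 : ℝ) ≤ (if h = 0 then (1 : ℝ) else 0); split_ifs <;> norm_num)
    (fun h hh => by show (if h = 0 then (1 : ℝ) else 0) = 0; rw [if_neg (by omega)]) (by simp) (by simp)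
    (fun k hk _ => by show (if k = 0 then (1 : ℝ) else 0) = 0; rw [if_neg (by omega)])
    (fun q _ _ j hj => absurd hj (Nat.not_lt_zero j))
  rw [slice_delta_zero a g ha, Nat.zero_add] at h
  exact h

/-- **the two-blob law does not depend on the order of the blobs**: `slice TP[0,a,g] b g′ = slice TP[0,b,g′] a g` (both are the law of
`a·ξ + b·ξ′`, `ξ ~ Bernoulli(g)`, `ξ′ ~ Bernoulli(g′)` independent). [this work] -/
theorem slice_blob_comm (a b : ℕ) (g g' : ℝ) :
    slice (fun h => TP[0, a, g, h]) b g' = slice (fun h => TP[0, b, g', h]) a g := by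
  funext h
  rw [slice_TP, slice_TP]
  simp only [Nat.zero_add]
  have e : ∀ (u v : ℕ), ((if h = u + v then (1 : ℝ) else 0) = if h = v + u then (1 : ℝ) else 0) := fun u v => by
    rw [Nat.add_comm]
  rw [e b a]
  ring

/-- **THE GATED TWO-BLOB LAW IS SDEC UP TO EVERY LEVEL** (`0 < x`, `Q ≤ 1`, `Qx < 1`, gates `x ≤ g, g′ ≤ 1`, sizes `1 ≤ a, b`):
`SDECUpTo x Q (a + b) (slice TP[0,a,g] b g′)`, i.e. for every gate `q ≤ Q` the law `gate_q({0,a;g} ∗ {0,b;g′})` of two relay bunches under a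
common gate is DEC at every layer below its top at floor `q·x`.  Proof: if `b ≤ a` slice the blob `TP[0,a,g]` (no atom in `(0,b)`) by
`{0,b;g′}`; otherwise swap the blobs (`slice_blob_comm`). [this work] -/
theorem sdecUpTo_twoBlob (x Q g g' : ℝ) (a b : ℕ) (hx0 : 0 < x) (hQ1 : Q ≤ 1) (hQx : Q * x < 1)
    (hxg : x ≤ g) (hg1 : g ≤ 1) (hxg' : x ≤ g') (hg'1 : g' ≤ 1) (ha : 1 ≤ a) (hb : 1 ≤ b) :
    SDECUpTo x Q (a + b) (slice (fun h => TP[0, a, g, h]) b g') := by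
  -- law facts of a heavy blob `TP[0, c, γ]` on `{0..c}`
  have blob0 : ∀ (c : ℕ) (γ : ℝ), 0 ≤ γ → γ ≤ 1 → ∀ h, 0 ≤ TP[0, c, γ, h] := fun c γ h0 h1 h => by
    have : (0 : ℝ) ≤ 1 - γ := by linarith
    positivity
  have blobM : ∀ (c : ℕ) (γ : ℝ), ∀ h, c < h → TP[0, c, γ, h] = 0 := fun c γ h hh => by
    rw [if_neg (by omega), if_neg (by omega)]; ring
  have blob1 : ∀ (c : ℕ) (γ : ℝ), ∑ h ∈ Finset.range (c + 1), TP[0, c, γ, h] = 1 := fun c γ => by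
    rw [Finset.sum_add_distrib, ← Finset.mul_sum, ← Finset.mul_sum, Finset.sum_ite_eq', Finset.sum_ite_eq',
      if_pos (Finset.mem_range.2 (Nat.lt_succ_self c)), if_pos (Finset.mem_range.2 (Nat.succ_pos c))]
    ring
  have blobmean : ∀ (c : ℕ) (γ : ℝ), ∑ h ∈ Finset.range (c + 1), (h : ℝ) * TP[0, c, γ, h] = (c : ℝ) * γ := fun c γ => by
    have e : ∀ h : ℕ, (h : ℝ) * TP[0, c, γ, h]
        = γ * (if h = c then (h : ℝ) else 0) + (1 - γ) * (if h = 0 then (h : ℝ) else 0) := fun h => by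
      split_ifs <;> ring
    simp_rw [e]
    rw [Finset.sum_add_distrib, ← Finset.mul_sum, ← Finset.mul_sum, Finset.sum_ite_eq', Finset.sum_ite_eq',
      if_pos (Finset.mem_range.2 (Nat.lt_succ_self c)), if_pos (Finset.mem_range.2 (Nat.succ_pos c))]
    push_cast; ring
  have hgap : ∀ (c d : ℕ) (γ : ℝ), d ≤ c → ∀ k, 0 < k → k < d → TP[0, c, γ, k] = 0 := fun c d γ hdc k hk hkd => by
    rw [if_neg (by omega), if_neg (by omega)]; ring
  by_cases hba : b ≤ a
  · exact sdecUpTo_slice_of_gap x Q g' b a (fun h => TP[0, a, g, h]) hx0 hQ1 hQx hxg' hg'1 hb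
      (blob0 a g (hx0.le.trans hxg) hg1) (blobM a g) (blob1 a g)
      (by rw [blobmean, mul_comm]; exact mul_le_mul_of_nonneg_left hxg (Nat.cast_nonneg a)) (hgap a b g hba)
      (sdecUpTo_blob x Q g a hx0 hQ1 hQx hxg hg1 ha)
  · have hab : a ≤ b := by omega
    rw [slice_blob_comm, Nat.add_comm]
    exact sdecUpTo_slice_of_gap x Q g a b (fun h => TP[0, b, g', h]) hx0 hQ1 hQx hxg hg1 ha
      (blob0 b g' (hx0.le.trans hxg') hg'1) (blobM b g') (blob1 b g')
      (by rw [blobmean, mul_comm]; exact mul_le_mul_of_nonneg_left hxg' (Nat.cast_nonneg b)) (hgap b a g' hab)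
      (sdecUpTo_blob x Q g' b hx0 hQ1 hQx hxg' hg'1 hb)

end LawDec

end Quant

end Summit.CriticalPhenomena.PercolationContinuityZ3.Theorems
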